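import Summits.QuantumFields.YangMills.Theorems.BalabanUVNodesN15SiteScalarLayerDressed
import Summits.QuantumFields.YangMills.Theorems.BalabanUVNodesN15ContourSums
import Summits.QuantumFields.YangMills.Theorems.BalabanUVNodesN15BackgroundAveragingWords
import Summits.QuantumFields.YangMills.Theorems.BalabanUVNodesN15FullPropagatorV1XSized
import HarnessLib

/-!
# Route «BalabanUVNodes», cluster K4 «SpineRates» — node N15 = NE2: THE SITE LAYER WITH THE BACKGROUND LIVE IN THE TwoGrid ENTRY CURRENCY, XVII — THE LINEARISED
# AVERAGING SPECIES OF THE SCALAR SITE LAYER AND ITS SIX LETTERS: `F₂(U) = Q∘M_{k(U)}`, `F₂*(U) = M_{k(U)}∘Q*` with the first-order contour kernel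
# `k(U)(x) = η·Σ_{b ∈ Γ_{B(x),x}} a(b)` READ OFF the bond coefficients — sup letters from `|a| ≤ r`, two-spacing fit letters from the contour projection
# (dag-n15-c `…N15ContourSums`) and the King-fibre oscillation of `a′`; at dag-n15-c's SIZED gauge-dressed family (FILE 40 `fgInstanceV1GS`, the operator
# carrier of parts XII∕XV) every letter a theorem of its `Reg335`, AT SIZE — the averaging-species letters a sized site bridge consumes

Cell `pub-ymgap`, WIDTH SEAT `pub-ymgap-dag-n15-w1` (generation 3; director-ym №197 ∕ HUMAN RULING D-0149; chair R455 (A) ∕ R461; plan g83 `W-SEAT-START-LIST.md` v11 §n15;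
g2's located leftover (γ) «an averaging species `F₂` for part XIII's binder», INBOX l.30136).  `bears_on: R4∕N15 · K3⁷ SpineGivenEndpointR13SepCoPH (stmt-QuantumFields-20544)`.
Filed `--supports stmt-QuantumFields-20544 --as helper` — COUNT-NEUTRAL.  Nine plumbing `def`s (the kernel, the four generic species, the four species of the sized family), the
rest theorems; 0 `sorry`.  Imports BY NAME, nothing in the tree modified: this seat's part IX `…N15SiteScalarLayerDressed` (`card_fibre_underPtN_ne`), dag-n15-c `…N15ContourSums`
(`lineSum`, `norm_lineSum_le`, **`norm_lineSum_two_spacing_le`**), (V5) `…N15BackgroundAveragingWords` (`fibAvg`, §5 `hasMaj_fibAvg_comp`, `hasMaj_idef_fibAvg_comp`) and FILE 40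
`…N15FullPropagatorV1XSized` (`fgInstanceV1GS`; through it `gavgM`, n15-b 13c `blockAvgV`∕`fit_blockAvgV`∕`norm_blockAvgV_le`, (V4) `fibre_conn_kingPrV`, `inv_pow_le_rate`), lit
`T4EtaRateCoeffDefect` (`hasMaj_mulOp`, `hasMaj_idef_mulOp`).

WHY.  Parts VI ∕ XIII typed the site socket's three letters and `NE2PlusSite` with the averaging perturbation of [Balaban1985BackgroundPropagators] (3.58) p.402
(«Q′(U′U) = Q′(U) + F′₂(A)») LIVE, over an averaging species `(F₂, F₂*)` carrying SIX DISPLAYED block-local letters (part XIII's `hF`: four sup letters `≤ diagK (r₀α₀)`, two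
two-spacing fits `≤ diagK (o₀(L^k)^{−γ∕2})`) — «no lane has typed an averaging species for the scalar site layer yet».  dag-n15-c's `…N15VectorPieceVWordsLinear` did it for the
VECTOR piece (`linKerC`, `linF_letters`: kernel `ad(η·Σ_Γ A′)` in coordinates).  THIS FILE is its site-carrier twin for REAL bond coefficients: the kernel is the first order of
(3.57)'s `U(Γ_{y,x}) − 1` along the one-level staircase contour from the block corner (dag-n15-c `lineSum`), abelianised — `k(x) = η·Σ_{b∈Γ_{B(x),x}} a(b)`, `η = 1∕n` at
spacing `n`; the species are `Q∘M_k` and `M_k∘Q*` with `Q = fibAvg` the plain unit-block mean ((V5) §5's model inhabitant, whose letters ARE the multiplier's).  THE LETTERS: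
a contour has `≤ (d+1)·n` bonds of weight `1∕n`, so `|k| ≤ (d+1)·r` from `|a| ≤ r` (`abs_siteAvgKer_le`); through King's pairing the fine contour to `x′` projects onto the coarse
contour to `pr x′` (`norm_lineSum_two_spacing_le`), so `|k′(x′) − k(pr x′)| ≤ (d+1)·(Ω + r∕L^k)` from the pointwise fit `|a′(b′) − a(pr b′)| ≤ Ω` (`abs_siteAvgKer_two_spacing_le`);
the multiplier letters pass through `Q` under the uniform King fibres (`card_fibre_underPtN_ne`).  AT THE SIZED FAMILY (§2): `a′ := φ ∘ A′` (an abelian component of the fine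
gauge field, `φ : 𝔄 →L[ℝ] ℝ` with `|φ a| ≤ ‖a‖`, the reading of parts XII∕XV), `a := φ ∘ Ā′` its King block mean, `Ω` = the fibre oscillation `2(d+1)(L^m − 1)·c₃₅M_jα₀η′` from the
one-step letters of `Reg335` ((V4) `fibre_conn_kingPrV`) — sizes `≤ (d+1)c₃₅M_jα₀`, fits `≤ (d+1)(2d+3)c₃₅M_jα₀·L^{−k} ≤ K_av (M_jα₀)(L^k)^{−γ∕2}`, `K_av = (d+1)(2d+3)c₃₅`,
every `γ ≤ 2`, every index; the primitive-carrier family's (unsized) edition is the companion `…N15SiteAveragingSpeciesC2`.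

CONTENTS.  §1 GENERIC — `siteAvgKer` (+ `_apply`), `abs_siteAvgKer_le`, `abs_siteAvgKer_two_spacing_le`; `siteAvgFc ∕ siteAvgFsc ∕ siteAvgFf ∕ siteAvgFsf`; ★★ `siteAvgSpecies_letters`
(the six letters in part XIII's frames from `r`, `Ω`).  §2 AT `fgInstanceV1GS` — `v1AvgFc ∕ v1AvgFsc ∕ v1AvgFf ∕ v1AvgFsf`, ★★ `v1AvgSpecies_letters` (the six letters AT SIZE from
`Reg335`, constant `K_av = (d+1)(2d+3)c₃₅`).

HONEST FRAMING.  Count-neutral helper; elementary lattice bookkeeping over DISPLAYED letters, no estimate of Bałaban's asserted.  MODEL-LEVEL exactly as parts X ∕ XII ∕ XV and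
dag-n15-c's linearised vector-piece species: the FIRST-ORDER, ABELIANISED kernel of the averaging perturbation read off the bond coefficients (no parallel transport, no colour, no
`R(·)`, one-level contour), `Q` the plain block mean at `U ≡ 1`, King's pairing; the starred kernel equal to the unstarred one (first order) — NOT the print's `F′₂ⱼ(A)` of
(3.55)–(3.58) (its one-spacing bound (3.58) is the Literature cell's `B9Eq358KeyEstimate` on another carrier), and the fit letter is NOT PRINTED (NE2⁺ is not).  NE2⁺ NOT PRINTED ∕
NOT proved; Node 00's [B9] layers of record are residual — **N15 is NOT discharged** (typed 28∕28 · discharged 5∕27 of record unchanged); K3⁷ OPEN, its N15 pin untouched; one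
finite four-torus programme at fixed `ε` — NOT ℝ⁴, NOT infinite volume, NOT OS, NOT a mass gap, NOT Clay; R4 closes the conditional finite-𝕋⁴ rung `BalabanLadder.UV` only.
Restate-immune.
-/

set_option autoImplicit false

noncomputable section

open scoped BigOperators
open Finset

namespace Summit.QuantumFields.YangMills.BalabanUVNodes.N15.SiteLayerBg

open Literature.MathematicalPhysics.QuantumFieldTheory.Balaban1983to89
open Literature.MathematicalPhysics.QuantumFieldTheory.Balaban1983to89.B11SectG (BlockNorm HasMaj)
open Literature.MathematicalPhysics.QuantumFieldTheory.Balaban1983to89.T4EtaRateDefect (idef)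
open Literature.MathematicalPhysics.QuantumFieldTheory.Balaban1983to89.T4EtaRateCoeffDefect (pull diagK diagK_mono fibre hasMaj_mulOp hasMaj_idef_mulOp)
open Literature.MathematicalPhysics.QuantumFieldTheory.Balaban1983to89.B5Prop11Plancherel (Tor fine)
open Literature.MathematicalPhysics.QuantumFieldTheory.Balaban1983to89.B6Prop26Gluing (mulOp mulOp_apply)
open Literature.MathematicalPhysics.QuantumFieldTheory.King1986.Torus (blockOf)
open Summit.QuantumFields.YangMills.BalabanUVNodes.N15.VectorPiece (unitTorusGeoS kingPr kingPrV kingPrV_eq bshiftEquiv lineSum norm_lineSum_le norm_lineSum_two_spacing_le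
  fibre_conn_kingPrV)
open Summit.QuantumFields.YangMills.BalabanUVNodes.N15.TwoGrid (TGIndex)
open Summit.QuantumFields.YangMills.BalabanUVNodes.N15.MatrixSpecies (blockAvgV fit_blockAvgV norm_blockAvgV_le)
open Summit.QuantumFields.YangMills.BalabanUVNodes.N15.BackgroundLayer (inv_pow_le_rate fibAvg hasMaj_fibAvg_comp hasMaj_idef_fibAvg_comp gavgM fgInstanceV1GS)
open Summit.QuantumFields.YangMills.BalabanUVNodes.N15.GenuineRecord (TGIndexS)
open Summit.QuantumFields.YangMills.BalabanUVNodes.N15KingModelRung.Curved (underPtN)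

variable {d : ℕ}

/-! ## §1 The linearised averaging kernel, the four species, the six letters (generic real bond coefficients) -/

section Kernel

variable (n : ℕ) [NeZero n] (Mn : Fin (d + 1) → ℕ) [∀ μ, NeZero (Mn μ)]

/-- THE LINEARISED AVERAGING KERNEL at spacing `η = 1∕n` for a real bond coefficient `a_μ` and a component `ν`: `k(x) = η·Σ_{b ∈ Γ_{B(x),x}} a(b)` — the first order of the
contour transport `U(Γ_{y,x}) − 1` of the averaging operator along the staircase from the block corner (dag-n15-c `lineSum`), abelianised.
[cite: Balaban1985BackgroundPropagators, (3.55)–(3.58) pp.401–402 (the kernel `F′₂(A; y, x)`: first-order shape)] -/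
def siteAvgKer (a : Fin (d + 1) → Tor (fine n Mn) × Fin (d + 1) → ℝ) (ν : Fin (d + 1)) : Tor (fine n Mn) → ℝ :=
  fun x => ((n : ℕ) : ℝ)⁻¹ * lineSum n Mn a (x, ν)

/-- Unfolding. [folklore] -/
theorem siteAvgKer_apply (a : Fin (d + 1) → Tor (fine n Mn) × Fin (d + 1) → ℝ) (ν : Fin (d + 1)) (x : Tor (fine n Mn)) :
    siteAvgKer n Mn a ν x = ((n : ℕ) : ℝ)⁻¹ * lineSum n Mn a (x, ν) := rfl

/-- THE SUP LETTER OF THE KERNEL: a contour has at most `(d+1)·n` bonds of weight `1∕n`, so `|k(x)| ≤ (d+1)·r` whenever `|a| ≤ r` (`r ≥ 0`).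
[cite: Balaban1985BackgroundPropagators, (3.58) p.402 («|F′₂ⱼ(A; y, x)| ≤ O(1)α₁»: shape)] -/
theorem abs_siteAvgKer_le {a : Fin (d + 1) → Tor (fine n Mn) × Fin (d + 1) → ℝ} {r : ℝ} (hr : 0 ≤ r) (ha : ∀ μ b, |a μ b| ≤ r) (ν : Fin (d + 1))
    (x : Tor (fine n Mn)) : |siteAvgKer n Mn a ν x| ≤ ((d : ℝ) + 1) * r := by
  have hn : (0 : ℝ) < ((n : ℕ) : ℝ) := by exact_mod_cast Nat.pos_of_ne_zero (NeZero.ne n)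
  have hls : |lineSum n Mn a (x, ν)| ≤ ((d : ℝ) + 1) * n * r := by
    have h := norm_lineSum_le n Mn (E := ℝ) hr (fun μ b => by rw [Real.norm_eq_abs]; exact ha μ b) (x, ν)
    rwa [Real.norm_eq_abs] at h
  rw [siteAvgKer_apply, abs_mul, abs_of_pos (inv_pos.2 hn)]
  calc ((n : ℕ) : ℝ)⁻¹ * |lineSum n Mn a (x, ν)| ≤ ((n : ℕ) : ℝ)⁻¹ * (((d : ℝ) + 1) * n * r) := mul_le_mul_of_nonneg_left hls (inv_nonneg.2 hn.le)
    _ = ((d : ℝ) + 1) * r := by field_simp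

end Kernel

section TwoSpacing

variable (L : ℕ) [NeZero L] (k m : ℕ) (Mn : Fin (d + 1) → ℕ) [∀ μ, NeZero (Mn μ)]

/-- THE TWO-SPACING FIT OF THE KERNEL THROUGH KING's PAIRING: fine spacing `1∕(L^mL^k)` with the coefficient `a′`, coarse spacing `1∕L^k` with `a`; if `|a′| ≤ r` and
`|a′_μ(b′) − a_μ(pr b′)| ≤ Ω` bond by bond (`r, Ω ≥ 0`), then `|k′(x′) − k(pr x′)| ≤ (d+1)·(Ω + r∕L^k)` — the fine contour to `x′` projects onto the coarse contour to `pr x′`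
(dag-n15-c `norm_lineSum_two_spacing_le` at `η′ = (L^mL^k)⁻¹`, `η = L^{−k} = L^m·η′`). [cite: Balaban1985BackgroundPropagators, (3.57)–(3.58) pp.401–402 (shape); King1986, p.664 (the pairing «x′ ∈ B^n(x)»)] -/
theorem abs_siteAvgKer_two_spacing_le {a' : Fin (d + 1) → Tor (fine (L ^ m * L ^ k) Mn) × Fin (d + 1) → ℝ}
    {a : Fin (d + 1) → Tor (fine (L ^ k) Mn) × Fin (d + 1) → ℝ} {r Ω : ℝ} (hr : 0 ≤ r) (hΩ : 0 ≤ Ω) (ha' : ∀ μ b, |a' μ b| ≤ r)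
    (hfit : ∀ μ b', |a' μ b' - a μ (kingPrV L k m Mn b')| ≤ Ω) (ν : Fin (d + 1)) (x' : Tor (fine (L ^ m * L ^ k) Mn)) :
    |siteAvgKer (L ^ m * L ^ k) Mn a' ν x' - siteAvgKer (L ^ k) Mn a ν (underPtN L k m Mn x')| ≤ ((d : ℝ) + 1) * (Ω + ((L ^ k : ℕ) : ℝ)⁻¹ * r) := by
  have hL0 : 0 < L := Nat.pos_of_ne_zero (NeZero.ne L)
  have hLk : (0 : ℝ) < ((L ^ k : ℕ) : ℝ) := by positivity
  have hLm : (0 : ℝ) < ((L ^ m : ℕ) : ℝ) := by positivity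
  set η' : ℝ := (((L ^ m * L ^ k : ℕ) : ℝ))⁻¹ with hη'
  set η : ℝ := (((L ^ k : ℕ) : ℝ))⁻¹ with hη
  have hη'0 : 0 ≤ η' := inv_nonneg.2 (by positivity)
  have hηη' : η = ((L ^ m : ℕ) : ℝ) * η' := by rw [hη, hη']; push_cast; field_simp
  have hls := norm_lineSum_two_spacing_le L k m Mn (E := ℝ) hr hΩ hη'0 hηη' (fun μ b => by rw [Real.norm_eq_abs]; exact ha' μ b)
    (fun μ b' => by rw [Real.norm_eq_abs]; exact hfit μ b') (x', ν)
  rw [Real.norm_eq_abs, smul_eq_mul, smul_eq_mul, kingPrV_eq] at hls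
  have e1 : ((L ^ k : ℕ) : ℝ) * ((L ^ m : ℕ) : ℝ) * η' = 1 := by rw [hη']; push_cast; field_simp
  have e2 : ((L ^ m : ℕ) : ℝ) * η' = η := hηη'.symm
  rw [e1, one_mul, e2] at hls
  -- `underPtN = kingPr` (same residue formula)
  exact hls

end TwoSpacing

section Species

variable (L : ℕ) [NeZero L] (Mn : Fin (d + 1) → ℕ) [∀ μ, NeZero (Mn μ)]

/-- THE COARSE AVERAGING SPECIES `F₂(a) = Q∘M_{k(a)}` at spacing `L^{−k}`: block mean of the kernel times the field (fine functions ↦ unit-lattice functions).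
[cite: Balaban1985BackgroundPropagators, (3.58)–(3.59) p.402 («(F′₂ⱼ(A)λ)(y)»: shape)] -/
def siteAvgFc (k : ℕ) (a : Fin (d + 1) → Tor (fine (L ^ k) Mn) × Fin (d + 1) → ℝ) (ν : Fin (d + 1)) : (Tor (fine (L ^ k) Mn) → ℝ) →ₗ[ℝ] (Tor Mn → ℝ) :=
  fibAvg (blockOf (L ^ k) Mn) ∘ₗ mulOp (siteAvgKer (L ^ k) Mn a ν)

/-- THE COARSE STARRED SPECIES `F₂*(a) = M_{k(a)}∘Q*`. [cite: Balaban1985BackgroundPropagators, (3.60) p.402 («F′₂*ⱼ(A) is not an adjoint of F′₂ⱼ(A)»: shape)] -/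
def siteAvgFsc (k : ℕ) (a : Fin (d + 1) → Tor (fine (L ^ k) Mn) × Fin (d + 1) → ℝ) (ν : Fin (d + 1)) : (Tor Mn → ℝ) →ₗ[ℝ] (Tor (fine (L ^ k) Mn) → ℝ) :=
  mulOp (siteAvgKer (L ^ k) Mn a ν) ∘ₗ pull (blockOf (L ^ k) Mn)

/-- THE FINE AVERAGING SPECIES `F₂′(a′) = Q′∘M_{k′(a′)}` at spacing `L^{−k}L^{−m}` (unit blocks reached through King's pairing). [cite: Balaban1985BackgroundPropagators, (3.58)–(3.59) p.402 (shape); King1986, p.664] -/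
def siteAvgFf (k m : ℕ) (a' : Fin (d + 1) → Tor (fine (L ^ m * L ^ k) Mn) × Fin (d + 1) → ℝ) (ν : Fin (d + 1)) :
    (Tor (fine (L ^ m * L ^ k) Mn) → ℝ) →ₗ[ℝ] (Tor Mn → ℝ) :=
  fibAvg (blockOf (L ^ k) Mn ∘ underPtN L k m Mn) ∘ₗ mulOp (siteAvgKer (L ^ m * L ^ k) Mn a' ν)

/-- THE FINE STARRED SPECIES `F₂*′(a′) = M_{k′(a′)}∘Q′*`. [cite: Balaban1985BackgroundPropagators, (3.60) p.402 (shape); King1986, p.664] -/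
def siteAvgFsf (k m : ℕ) (a' : Fin (d + 1) → Tor (fine (L ^ m * L ^ k) Mn) × Fin (d + 1) → ℝ) (ν : Fin (d + 1)) :
    (Tor Mn → ℝ) →ₗ[ℝ] (Tor (fine (L ^ m * L ^ k) Mn) → ℝ) :=
  mulOp (siteAvgKer (L ^ m * L ^ k) Mn a' ν) ∘ₗ pull (blockOf (L ^ k) Mn ∘ underPtN L k m Mn)

/-- ★★ **THE SIX LETTERS OF THE LINEARISED AVERAGING SPECIES** in part XIII's frames (King's unit blocks of the sized carrier `unitTorusGeoS L k Mn M_sz`): from `|a′|, |a| ≤ r` and the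
pointwise King-fibre fit `|a′_μ(b′) − a_μ(pr b′)| ≤ Ω` (`r, Ω ≥ 0`) — the four sup letters `F₂(a), F₂*(a), F₂′(a′), F₂*′(a′) ≤ diagK ((d+1)r)` and the two fits
`𝔇_{(pull π, 1)}(F₂′, F₂), 𝔇_{(1, pull π)}(F₂*′, F₂*) ≤ diagK ((d+1)(Ω + r∕L^k))` ((V5) §5 through the uniform King fibres).
[cite: Balaban1985BackgroundPropagators, (3.58)–(3.59) p.402 (the sup letter: shape); King1986, Prop. 3.8 p.664 (pairing, template)] -/
theorem siteAvgSpecies_letters (k m : ℕ) (Msz : ℝ) {a' : Fin (d + 1) → Tor (fine (L ^ m * L ^ k) Mn) × Fin (d + 1) → ℝ}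
    {a : Fin (d + 1) → Tor (fine (L ^ k) Mn) × Fin (d + 1) → ℝ} {r Ω : ℝ} (hr : 0 ≤ r) (hΩ : 0 ≤ Ω) (ha' : ∀ μ b, |a' μ b| ≤ r) (ha : ∀ μ b, |a μ b| ≤ r)
    (hfit : ∀ μ b', |a' μ b' - a μ (kingPrV L k m Mn b')| ≤ Ω) (ν : Fin (d + 1)) :
    HasMaj (BlockNorm.ofBlocks (unitTorusGeoS L k Mn Msz) (blockOf (L ^ k) Mn)) (BlockNorm.ofBlocks (unitTorusGeoS L k Mn Msz) (fun y : Tor Mn => y))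
        (siteAvgFc L Mn k a ν) (diagK fun _ => ((d : ℝ) + 1) * r) ∧
      HasMaj (BlockNorm.ofBlocks (unitTorusGeoS L k Mn Msz) (fun y : Tor Mn => y)) (BlockNorm.ofBlocks (unitTorusGeoS L k Mn Msz) (blockOf (L ^ k) Mn))
        (siteAvgFsc L Mn k a ν) (diagK fun _ => ((d : ℝ) + 1) * r) ∧
      HasMaj (BlockNorm.ofBlocks (unitTorusGeoS L k Mn Msz) (blockOf (L ^ k) Mn ∘ underPtN L k m Mn)) (BlockNorm.ofBlocks (unitTorusGeoS L k Mn Msz) (fun y : Tor Mn => y))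
        (siteAvgFf L Mn k m a' ν) (diagK fun _ => ((d : ℝ) + 1) * r) ∧
      HasMaj (BlockNorm.ofBlocks (unitTorusGeoS L k Mn Msz) (fun y : Tor Mn => y)) (BlockNorm.ofBlocks (unitTorusGeoS L k Mn Msz) (blockOf (L ^ k) Mn ∘ underPtN L k m Mn))
        (siteAvgFsf L Mn k m a' ν) (diagK fun _ => ((d : ℝ) + 1) * r) ∧
      HasMaj (BlockNorm.ofBlocks (unitTorusGeoS L k Mn Msz) (blockOf (L ^ k) Mn)) (BlockNorm.ofBlocks (unitTorusGeoS L k Mn Msz) (fun y : Tor Mn => y))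
        (idef (pull (underPtN L k m Mn)) LinearMap.id (siteAvgFf L Mn k m a' ν) (siteAvgFc L Mn k a ν)) (diagK fun _ => ((d : ℝ) + 1) * (Ω + ((L ^ k : ℕ) : ℝ)⁻¹ * r)) ∧
      HasMaj (BlockNorm.ofBlocks (unitTorusGeoS L k Mn Msz) (fun y : Tor Mn => y)) (BlockNorm.ofBlocks (unitTorusGeoS L k Mn Msz) (blockOf (L ^ k) Mn ∘ underPtN L k m Mn))
        (idef LinearMap.id (pull (underPtN L k m Mn)) (siteAvgFsf L Mn k m a' ν) (siteAvgFsc L Mn k a ν)) (diagK fun _ => ((d : ℝ) + 1) * (Ω + ((L ^ k : ℕ) : ℝ)⁻¹ * r)) := by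
  have hd : (0 : ℝ) ≤ (d : ℝ) + 1 := by positivity
  have hLk : (0 : ℝ) ≤ ((L ^ k : ℕ) : ℝ)⁻¹ := inv_nonneg.2 (Nat.cast_nonneg _)
  have hR : 0 ≤ ((d : ℝ) + 1) * r := mul_nonneg hd hr
  have hO : 0 ≤ ((d : ℝ) + 1) * (Ω + ((L ^ k : ℕ) : ℝ)⁻¹ * r) := mul_nonneg hd (add_nonneg hΩ (mul_nonneg hLk hr))
  -- the multipliers' letters
  have hMc := hasMaj_mulOp (g := unitTorusGeoS L k Mn Msz) (blockOf (L ^ k) Mn) (a := siteAvgKer (L ^ k) Mn a ν) (m := fun _ => ((d : ℝ) + 1) * r)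
    (fun _ => hR) (fun x => abs_siteAvgKer_le (L ^ k) Mn hr ha ν x)
  have hMf := hasMaj_mulOp (g := unitTorusGeoS L k Mn Msz) (blockOf (L ^ k) Mn ∘ underPtN L k m Mn) (a := siteAvgKer (L ^ m * L ^ k) Mn a' ν)
    (m := fun _ => ((d : ℝ) + 1) * r) (fun _ => hR) (fun x' => abs_siteAvgKer_le (L ^ m * L ^ k) Mn hr ha' ν x')
  have hMD := hasMaj_idef_mulOp (g := unitTorusGeoS L k Mn Msz) (blockOf (L ^ k) Mn) (underPtN L k m Mn) (a' := siteAvgKer (L ^ m * L ^ k) Mn a' ν)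
    (a := siteAvgKer (L ^ k) Mn a ν) (o := fun _ => ((d : ℝ) + 1) * (Ω + ((L ^ k : ℕ) : ℝ)⁻¹ * r)) (fun _ => hO)
    (fun x' => abs_siteAvgKer_two_spacing_le L k m Mn hr hΩ ha' hfit ν x')
  -- through the block mean (uniform King fibres)
  have hq : ∀ x : Tor (fine (L ^ k) Mn), blockOf (L ^ k) Mn x = (fun y : Tor Mn => y) (blockOf (L ^ k) Mn x) := fun _ => rfl
  obtain ⟨N, hN, hfib⟩ := card_fibre_underPtN_ne (L := L) k m Mn
  obtain ⟨h1, h2⟩ := hasMaj_fibAvg_comp (g := unitTorusGeoS L k Mn Msz) (blockOf (L ^ k) Mn) (fun y : Tor Mn => y) (blockOf (L ^ k) Mn) hq hR hMc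
  obtain ⟨h3, h4⟩ := hasMaj_fibAvg_comp (g := unitTorusGeoS L k Mn Msz) (blockOf (L ^ k) Mn ∘ underPtN L k m Mn) (fun y : Tor Mn => y)
    (blockOf (L ^ k) Mn ∘ underPtN L k m Mn) (fun _ => rfl) hR hMf
  obtain ⟨h5, h6⟩ := hasMaj_idef_fibAvg_comp (g := unitTorusGeoS L k Mn Msz) (blockOf (L ^ k) Mn) (fun y : Tor Mn => y) (blockOf (L ^ k) Mn) (underPtN L k m Mn)
    hq hN hfib hO hMD
  exact ⟨h1, h2, h3, h4, h5, h6⟩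

end Species

/-! ## §2 At dag-n15-c's SIZED gauge-dressed family (FILE 40 `fgInstanceV1GS`): the species reading an abelian component `φ ∘ A′`, letters AT SIZE -/

section Sized

variable {L : ℕ} [NeZero L]
variable (d) (𝔄 : Type) [NormedRing 𝔄] [NormedAlgebra ℝ 𝔄] [CompleteSpace 𝔄] (ι : Type) [Fintype ι] [DecidableEq ι] [Nonempty ι] (φ : 𝔄 →L[ℝ] ℝ)

/-- THE COARSE AVERAGING SPECIES OF THE SIZED GAUGE-DRESSED FAMILY at index `(j, ν)`: §1's `F₂` for the real bond coefficient `φ ∘ B` (an abelian component of a coarse gauge field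
`B`; `φ : 𝔄 →L[ℝ] ℝ` a datum), component `ν`. [cite: Balaban1985BackgroundPropagators, (3.58) p.402 (shape)] -/
def v1AvgFc (hL : Odd L ∧ 1 < L) (j : TGIndexS × Fin (d + 1)) (B : (fgInstanceV1GS d 𝔄 ι hL j).Bc.Cfg) :
    (Tor (fine (L ^ j.1.k) (TGIndex.Mn d hL j.1.toTGIndex)) → ℝ) →ₗ[ℝ] (Tor (TGIndex.Mn d hL j.1.toTGIndex) → ℝ) :=
  siteAvgFc L (TGIndex.Mn d hL j.1.toTGIndex) j.1.k (fun μ b => φ (B μ b)) j.2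

/-- THE COARSE STARRED AVERAGING SPECIES OF THE SIZED FAMILY. [cite: Balaban1985BackgroundPropagators, (3.60) p.402 (shape)] -/
def v1AvgFsc (hL : Odd L ∧ 1 < L) (j : TGIndexS × Fin (d + 1)) (B : (fgInstanceV1GS d 𝔄 ι hL j).Bc.Cfg) :
    (Tor (TGIndex.Mn d hL j.1.toTGIndex) → ℝ) →ₗ[ℝ] (Tor (fine (L ^ j.1.k) (TGIndex.Mn d hL j.1.toTGIndex)) → ℝ) :=
  siteAvgFsc L (TGIndex.Mn d hL j.1.toTGIndex) j.1.k (fun μ b => φ (B μ b)) j.2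

/-- THE FINE AVERAGING SPECIES OF THE SIZED FAMILY (abelian component `φ ∘ A′` of the fine gauge field). [cite: Balaban1985BackgroundPropagators, (3.58) p.402 (shape)] -/
def v1AvgFf (hL : Odd L ∧ 1 < L) (j : TGIndexS × Fin (d + 1)) (A : (fgInstanceV1GS d 𝔄 ι hL j).Bf.Cfg) :
    (Tor (fine (L ^ j.1.m * L ^ j.1.k) (TGIndex.Mn d hL j.1.toTGIndex)) → ℝ) →ₗ[ℝ] (Tor (TGIndex.Mn d hL j.1.toTGIndex) → ℝ) :=
  siteAvgFf L (TGIndex.Mn d hL j.1.toTGIndex) j.1.k j.1.m (fun μ b => φ (A μ b)) j.2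

/-- THE FINE STARRED AVERAGING SPECIES OF THE SIZED FAMILY. [cite: Balaban1985BackgroundPropagators, (3.60) p.402 (shape)] -/
def v1AvgFsf (hL : Odd L ∧ 1 < L) (j : TGIndexS × Fin (d + 1)) (A : (fgInstanceV1GS d 𝔄 ι hL j).Bf.Cfg) :
    (Tor (TGIndex.Mn d hL j.1.toTGIndex) → ℝ) →ₗ[ℝ] (Tor (fine (L ^ j.1.m * L ^ j.1.k) (TGIndex.Mn d hL j.1.toTGIndex)) → ℝ) :=
  siteAvgFsf L (TGIndex.Mn d hL j.1.toTGIndex) j.1.k j.1.m (fun μ b => φ (A μ b)) j.2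

variable {d 𝔄 ι φ}

omit [CompleteSpace 𝔄] [DecidableEq ι] [Nonempty ι] in
/-- ★★ **THE SIX LETTERS OF THE SIZED FAMILY's AVERAGING SPECIES, AT SIZE, FROM `Reg335`** at every index `(j, ν)` of FILE 40's family and every `γ ≤ 2`: for a functional `|φ a| ≤ ‖a‖`,
`α₀ > 0` and a fine gauge field `A′` in the (3.35) window at `(c₃₅, α₀)` (letters `‖A′‖ ≤ c₃₅M_jα₀`, one-step differences `≤ c₃₅M_jα₀·η′`, `η′ = L^{−k}L^{−m}`) — sup letters
`≤ diagK (K_av (M_jα₀))` for `F₂(Ā′), F₂*(Ā′), F₂′(A′), F₂*′(A′)` and fits `≤ diagK (K_av (M_jα₀)(L^k)^{−γ∕2})` (King-fibre oscillation `fibre_conn_kingPrV` `≤ 2(d+1)(L^m − 1)c₃₅M_jα₀η′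
≤ 2(d+1)c₃₅M_jα₀L^{−k}`, `fit_blockAvgV`, §1's fit `(d+1)(Ω + r∕L^k)`); `K_av = (d+1)(2d+3)c₃₅`. [cite: Balaban1985BackgroundPropagators, (3.35) p.396 («|A| < O(1)Mα₀»: the letters at size, shape), (3.58) p.402 (shape); King1986, p.664 (pairing)] -/
theorem v1AvgSpecies_letters (hL : Odd L ∧ 1 < L) {c35 : ℝ} (hc35 : 0 ≤ c35) {γ : ℝ} (hγ2 : γ ≤ 2) (hφ : ∀ a : 𝔄, |φ a| ≤ ‖a‖) (j : TGIndexS × Fin (d + 1))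
    {α₀ : ℝ} (hα₀ : 0 < α₀) (A : (fgInstanceV1GS d 𝔄 ι hL j).Bf.Cfg) (hA : (fgInstanceV1GS d 𝔄 ι hL j).Bf.Reg335 c35 α₀ A) :
    HasMaj (BlockNorm.ofBlocks (unitTorusGeoS L j.1.k (TGIndex.Mn d hL j.1.toTGIndex) j.1.Msz) (blockOf (L ^ j.1.k) (TGIndex.Mn d hL j.1.toTGIndex)))
        (BlockNorm.ofBlocks (unitTorusGeoS L j.1.k (TGIndex.Mn d hL j.1.toTGIndex) j.1.Msz) (fun y : Tor (TGIndex.Mn d hL j.1.toTGIndex) => y))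
        (v1AvgFc d 𝔄 ι φ hL j ((fgInstanceV1GS d 𝔄 ι hL j).pair.avg A)) (diagK fun _ => ((d : ℝ) + 1) * (2 * (d : ℝ) + 3) * c35 * (j.1.Msz * α₀)) ∧
      HasMaj (BlockNorm.ofBlocks (unitTorusGeoS L j.1.k (TGIndex.Mn d hL j.1.toTGIndex) j.1.Msz) (fun y : Tor (TGIndex.Mn d hL j.1.toTGIndex) => y))
        (BlockNorm.ofBlocks (unitTorusGeoS L j.1.k (TGIndex.Mn d hL j.1.toTGIndex) j.1.Msz) (blockOf (L ^ j.1.k) (TGIndex.Mn d hL j.1.toTGIndex)))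
        (v1AvgFsc d 𝔄 ι φ hL j ((fgInstanceV1GS d 𝔄 ι hL j).pair.avg A)) (diagK fun _ => ((d : ℝ) + 1) * (2 * (d : ℝ) + 3) * c35 * (j.1.Msz * α₀)) ∧
      HasMaj (BlockNorm.ofBlocks (unitTorusGeoS L j.1.k (TGIndex.Mn d hL j.1.toTGIndex) j.1.Msz)
          (blockOf (L ^ j.1.k) (TGIndex.Mn d hL j.1.toTGIndex) ∘ underPtN L j.1.k j.1.m (TGIndex.Mn d hL j.1.toTGIndex)))
        (BlockNorm.ofBlocks (unitTorusGeoS L j.1.k (TGIndex.Mn d hL j.1.toTGIndex) j.1.Msz) (fun y : Tor (TGIndex.Mn d hL j.1.toTGIndex) => y))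
        (v1AvgFf d 𝔄 ι φ hL j A) (diagK fun _ => ((d : ℝ) + 1) * (2 * (d : ℝ) + 3) * c35 * (j.1.Msz * α₀)) ∧
      HasMaj (BlockNorm.ofBlocks (unitTorusGeoS L j.1.k (TGIndex.Mn d hL j.1.toTGIndex) j.1.Msz) (fun y : Tor (TGIndex.Mn d hL j.1.toTGIndex) => y))
        (BlockNorm.ofBlocks (unitTorusGeoS L j.1.k (TGIndex.Mn d hL j.1.toTGIndex) j.1.Msz)
          (blockOf (L ^ j.1.k) (TGIndex.Mn d hL j.1.toTGIndex) ∘ underPtN L j.1.k j.1.m (TGIndex.Mn d hL j.1.toTGIndex)))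
        (v1AvgFsf d 𝔄 ι φ hL j A) (diagK fun _ => ((d : ℝ) + 1) * (2 * (d : ℝ) + 3) * c35 * (j.1.Msz * α₀)) ∧
      HasMaj (BlockNorm.ofBlocks (unitTorusGeoS L j.1.k (TGIndex.Mn d hL j.1.toTGIndex) j.1.Msz) (blockOf (L ^ j.1.k) (TGIndex.Mn d hL j.1.toTGIndex)))
        (BlockNorm.ofBlocks (unitTorusGeoS L j.1.k (TGIndex.Mn d hL j.1.toTGIndex) j.1.Msz) (fun y : Tor (TGIndex.Mn d hL j.1.toTGIndex) => y))
        (idef (pull (underPtN L j.1.k j.1.m (TGIndex.Mn d hL j.1.toTGIndex))) LinearMap.id (v1AvgFf d 𝔄 ι φ hL j A)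
          (v1AvgFc d 𝔄 ι φ hL j ((fgInstanceV1GS d 𝔄 ι hL j).pair.avg A)))
        (diagK fun _ => ((d : ℝ) + 1) * (2 * (d : ℝ) + 3) * c35 * (j.1.Msz * α₀) * ((L : ℝ) ^ j.1.k) ^ (-(γ / 2))) ∧
      HasMaj (BlockNorm.ofBlocks (unitTorusGeoS L j.1.k (TGIndex.Mn d hL j.1.toTGIndex) j.1.Msz) (fun y : Tor (TGIndex.Mn d hL j.1.toTGIndex) => y))
        (BlockNorm.ofBlocks (unitTorusGeoS L j.1.k (TGIndex.Mn d hL j.1.toTGIndex) j.1.Msz)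
          (blockOf (L ^ j.1.k) (TGIndex.Mn d hL j.1.toTGIndex) ∘ underPtN L j.1.k j.1.m (TGIndex.Mn d hL j.1.toTGIndex)))
        (idef LinearMap.id (pull (underPtN L j.1.k j.1.m (TGIndex.Mn d hL j.1.toTGIndex))) (v1AvgFsf d 𝔄 ι φ hL j A)
          (v1AvgFsc d 𝔄 ι φ hL j ((fgInstanceV1GS d 𝔄 ι hL j).pair.avg A)))
        (diagK fun _ => ((d : ℝ) + 1) * (2 * (d : ℝ) + 3) * c35 * (j.1.Msz * α₀) * ((L : ℝ) ^ j.1.k) ^ (-(γ / 2))) := by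
  obtain ⟨hA1, hA2, -⟩ := hA
  set M := TGIndex.Mn d hL j.1.toTGIndex with hMdef
  set k := j.1.k with hkdef
  set m := j.1.m with hmdef
  set ν := j.2 with hνdef
  have hL0 : 0 < L := Nat.pos_of_ne_zero (NeZero.ne L)
  have hL1 : (1 : ℝ) ≤ (L : ℝ) := by exact_mod_cast hL0
  have hMsz : 0 ≤ j.1.Msz := le_trans zero_le_one j.1.one_le_Msz
  have hr : 0 ≤ c35 * (j.1.Msz * α₀) := mul_nonneg hc35 (mul_nonneg hMsz hα₀.le)
  have hd0 : (0 : ℝ) ≤ d := Nat.cast_nonneg d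
  have hθ : 0 ≤ ((L : ℝ) ^ k) ^ (-(γ / 2)) := Real.rpow_nonneg (pow_nonneg (Nat.cast_nonneg _) _) _
  -- the size letter of the gauge field, read as `c₃₅·(M_j·α₀)`
  have hM1 : c35 * (unitTorusGeoS L j.1.k (TGIndex.Mn d hL j.1.toTGIndex) j.1.Msz).M * α₀ = c35 * (j.1.Msz * α₀) := by
    rw [show (unitTorusGeoS L j.1.k (TGIndex.Mn d hL j.1.toTGIndex) j.1.Msz).M = j.1.Msz from rfl, mul_assoc]
  have hAn : ∀ μ b, ‖A μ b‖ ≤ c35 * (j.1.Msz * α₀) := fun μ b => (hA1 μ b).trans_eq hM1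
  have havg : (fgInstanceV1GS d 𝔄 ι hL j).pair.avg A = gavgM 𝔄 (Fin (d + 1)) (kingPrV L k m M) A := rfl
  rw [havg]
  -- the two real bond coefficients and their sup letters
  have ha' : ∀ μ b, |φ (A μ b)| ≤ c35 * (j.1.Msz * α₀) := fun μ b => (hφ _).trans (hAn μ b)
  have ha : ∀ μ b, |φ (gavgM 𝔄 (Fin (d + 1)) (kingPrV L k m M) A μ b)| ≤ c35 * (j.1.Msz * α₀) := fun μ b =>
    (hφ _).trans (norm_blockAvgV_le _ hr (hAn μ) _)
  -- the pointwise fit through King's pairing: within the fibre oscillation of `A′`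
  have hη : (unitTorusGeoS L j.1.k (TGIndex.Mn d hL j.1.toTGIndex) j.1.Msz).eta * ((unitTorusGeoS L j.1.k (TGIndex.Mn d hL j.1.toTGIndex) j.1.Msz).L ^ m)⁻¹
      = (((L : ℝ) ^ k))⁻¹ * (((L : ℝ) ^ m))⁻¹ := rfl
  have hstep : ∀ μ κ b, ‖A μ (bshiftEquiv M (L ^ m * L ^ k) κ b) - A μ b‖ ≤ c35 * (j.1.Msz * α₀) * ((((L : ℝ) ^ k))⁻¹ * (((L : ℝ) ^ m))⁻¹) := fun μ κ b => by
    have h := hA2 μ κ b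
    rw [hη] at h
    exact h.trans_eq (by rw [show (unitTorusGeoS L j.1.k (TGIndex.Mn d hL j.1.toTGIndex) j.1.Msz).M = j.1.Msz from rfl]; ring)
  set Ω : ℝ := ((2 * ((d + 1) * (L ^ m - 1)) : ℕ) : ℝ) * (c35 * (j.1.Msz * α₀) * ((((L : ℝ) ^ k))⁻¹ * (((L : ℝ) ^ m))⁻¹)) with hΩdef
  have hΩ0 : 0 ≤ Ω := by positivity
  have hfit : ∀ μ b', |φ (A μ b') - φ (gavgM 𝔄 (Fin (d + 1)) (kingPrV L k m M) A μ (kingPrV L k m M b'))| ≤ Ω := fun μ b' => by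
    rw [← map_sub]
    exact (hφ _).trans (fit_blockAvgV (kingPrV L k m M) (Ω := fun _ => Ω) (fun x₁' x₂' h => fibre_conn_kingPrV L k m M (A μ) _ (fun κ i => hstep μ κ i) x₁' x₂' h) b')
  -- the oscillation bound `Ω ≤ 2(d+1)c₃₅(M_jα₀)·L^{−k}`
  have hΩle : Ω ≤ 2 * ((d : ℝ) + 1) * (c35 * (j.1.Msz * α₀)) * (((L ^ k : ℕ) : ℝ))⁻¹ := by
    have hLm : (0 : ℝ) < (L : ℝ) ^ m := by positivity
    have hLk : (0 : ℝ) < (L : ℝ) ^ k := by positivity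
    have h1 : ((2 * ((d + 1) * (L ^ m - 1)) : ℕ) : ℝ) ≤ 2 * ((d : ℝ) + 1) * (L : ℝ) ^ m := by
      have : ((L ^ m - 1 : ℕ) : ℝ) ≤ ((L ^ m : ℕ) : ℝ) := by exact_mod_cast Nat.sub_le _ _
      push_cast [Nat.cast_sub (Nat.one_le_pow _ _ hL0)] at this ⊢
      nlinarith
    calc Ω ≤ 2 * ((d : ℝ) + 1) * (L : ℝ) ^ m * (c35 * (j.1.Msz * α₀) * ((((L : ℝ) ^ k))⁻¹ * (((L : ℝ) ^ m))⁻¹)) := mul_le_mul_of_nonneg_right h1 (by positivity)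
      _ = 2 * ((d : ℝ) + 1) * (c35 * (j.1.Msz * α₀)) * (((L ^ k : ℕ) : ℝ))⁻¹ := by push_cast; field_simp
  -- §1's six letters at `r = c₃₅(M_jα₀)`, `Ω`
  obtain ⟨h1, h2, h3, h4, h5, h6⟩ := siteAvgSpecies_letters L M k m j.1.Msz (a' := fun μ b => φ (A μ b))
    (a := fun μ b => φ (gavgM 𝔄 (Fin (d + 1)) (kingPrV L k m M) A μ b)) hr hΩ0 ha' ha hfit ν
  have hsize : ((d : ℝ) + 1) * (c35 * (j.1.Msz * α₀)) ≤ ((d : ℝ) + 1) * (2 * (d : ℝ) + 3) * c35 * (j.1.Msz * α₀) := by nlinarith [mul_nonneg hd0 hr]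
  have hrate : (((L ^ k : ℕ) : ℝ))⁻¹ ≤ ((L : ℝ) ^ k) ^ (-(γ / 2)) := inv_pow_le_rate (L := L) hL1 (by linarith)
  have hfitc : ((d : ℝ) + 1) * (Ω + (((L ^ k : ℕ) : ℝ))⁻¹ * (c35 * (j.1.Msz * α₀)))
      ≤ ((d : ℝ) + 1) * (2 * (d : ℝ) + 3) * c35 * (j.1.Msz * α₀) * ((L : ℝ) ^ k) ^ (-(γ / 2)) := by
    have h1 : Ω + (((L ^ k : ℕ) : ℝ))⁻¹ * (c35 * (j.1.Msz * α₀)) ≤ (2 * ((d : ℝ) + 1) + 1) * (c35 * (j.1.Msz * α₀)) * (((L ^ k : ℕ) : ℝ))⁻¹ := by nlinarith [hΩle]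
    have h2 : (2 * ((d : ℝ) + 1) + 1) * (c35 * (j.1.Msz * α₀)) * (((L ^ k : ℕ) : ℝ))⁻¹ ≤ (2 * ((d : ℝ) + 1) + 1) * (c35 * (j.1.Msz * α₀)) * ((L : ℝ) ^ k) ^ (-(γ / 2)) :=
      mul_le_mul_of_nonneg_left hrate (by positivity)
    calc ((d : ℝ) + 1) * (Ω + (((L ^ k : ℕ) : ℝ))⁻¹ * (c35 * (j.1.Msz * α₀)))
        ≤ ((d : ℝ) + 1) * ((2 * ((d : ℝ) + 1) + 1) * (c35 * (j.1.Msz * α₀)) * ((L : ℝ) ^ k) ^ (-(γ / 2))) := mul_le_mul_of_nonneg_left (h1.trans h2) (by positivity)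
      _ = ((d : ℝ) + 1) * (2 * (d : ℝ) + 3) * c35 * (j.1.Msz * α₀) * ((L : ℝ) ^ k) ^ (-(γ / 2)) := by ring
  exact ⟨h1.mono fun y y' => diagK_mono (fun _ => hsize) y y', h2.mono fun y y' => diagK_mono (fun _ => hsize) y y',
    h3.mono fun y y' => diagK_mono (fun _ => hsize) y y', h4.mono fun y y' => diagK_mono (fun _ => hsize) y y',
    h5.mono fun y y' => diagK_mono (fun _ => hfitc) y y', h6.mono fun y y' => diagK_mono (fun _ => hfitc) y y'⟩

end Sized

end Summit.QuantumFields.YangMills.BalabanUVNodes.N15.SiteLayerBg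

end
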